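import Summits.CriticalPhenomena.PercolationContinuityZ3.Theorems.Transplant.SkelFrmBParamsSlotsRS
import Summits.CriticalPhenomena.PercolationContinuityZ3.Theorems.Transplant.SkelFrmBParamsRootA
import Summits.CriticalPhenomena.PercolationContinuityZ3.Theorems.Transplant.SkelFrmBChoiceNums
import Summits.CriticalPhenomena.PercolationContinuityZ3.Theorems.Transplant.PlanarSkeletonFrmDefs
import Summits.CriticalPhenomena.PercolationContinuityZ3.Theorems.Transplant.SkelPhiStepIDataNS
import HarnessLib
/-!
# N2 (frames-only node `SamePDropOfSkeletonFrm₁`, OPEN), (F) value layer — part BridgeF: **THE WIDE BRIDGE PAIR FOR THE y′-FACE AT THE (S0) KIT LEVELS**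
# (hp-8 g42, 2026-08-23; F-DISCHARGE-MAP-N2 (Δ3)/G8; N1 `SkelNegBParamsBridgeF` (stmt-g15) ported by `port_frm.py` ((ζ″) shape (B′): carrier `PlanarSkeletonFrm`,
# record `DataNS`, section variables inlined) with ONE value re-point: the kit's level radius `RA′ mk ↦ NegB.KS0.R'0 … mk` (the (S0) re-centred kit of record,
# SkelFrmBChoiceNums p347587 — the keystone's `hRl₁ : Rlev₁ + 1 ≤ (B σ').R'` reads `Rlev₁ := KS0.Rlev0`, `R'0 = Rlev0 + 1`)):
# clearance `bF c := M_u + (c+2)·R'0 + 1`, zone index `mbF c := max (2·bF + 26) (24·M_u + 63)`, pair `(MBF, nBF) := (MB D mbF, nB D mbF bF)`, data `hBF/ℓBF/vBF`,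
# the extra-pair slot `PxF c : PSlot`, and `RF2F` / `MBF_floors` / `bridgeF_adm` / `ℓBF_ge` / **`clearF : M_u + (c+1)·R'0 < nBF − R'0`**, `mem_PxF`.
WHY THE FACE KEEPS ITS OWN (WIDE) PAIR IN N2: the y′-face route is bridge → y′-run (`Nr+1 ≈ 20K` hops, recession `(Nr+1)·R′` in α) → x-run, and the run's α-clearance
from the seed zone is served from the k = 0 floor by a bridge of clearance `(c+2)·R′` with `c := 1000·Kq + 1` (N1 (L-F1) (ii), ClearF) — the root's bridge pair of
(R-37) (stmt's planned `SkelFrmBParamsBridge0`: `b0 := Rs + R'0 + e + RL + 2`) is far too short for that.  SLOT CONSEQUENCE (located, for the node-file slot tuple,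
stmt-g21/p3-g16): the pair slot `Pv` of `frmChoiceAllQ3T gv fv Pv Sv cv bv` must contain `(MBF c mk, nBF c mk)` — N1 v3 had `Pv := KS.PR 0 KS.PxFK` with
`PxFK := PxF (cK κ) 0`, `cK κ = 1000·Kq + 1` (ResidualsAK) — i.e. `Pv := PR 0 (Px0 ⊎ PxF (cF κ) 0)` or equivalent; `mem_PxF` below is stated at the exact slot `PR mk (PxF c mk)`
as in N1 and a `⊆`-monotone variant is one line when the union slot is named.
Everything else is the generic part-B API of SkelFrmBParamsB (`MB/nB/hB/ℓB/vB`, `nB_facts`, `MB_facts`, `bridge_adm`, `ℓB_ge`, `RF2_at`, `MB_floors`) at `(mb, b) := (mbF c, bF c)`.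
NON-VACUITY (lead g11 standing order 2026-08-23T03:52:56Z): definitions + their arithmetic; the only hypothesis row is `ℓBF_ge`'s `EqGeom` at the pair, discharged at the
choice function by `clauseP`-type membership (`mem_PxF`) exactly as in N1's Y2TA.
builds on p205010 (kernel theorem, internal audit signed; external expert review pending) — nothing in this file uses p205010; NOTHING is claimed about the
open node `SamePDropOfSkeletonFrm₁` (`SamePDropOfSkeletonNeg₁` is CLOSED in the tree and untouched by this file).
Status sentence (coordinator 2026-08-20T04:30Z): "θ(p_c) = 0 on ℤ^d, all d ≥ 2 — kernel-verified (Lean 4/Mathlib, standard axioms); internal adversarial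
audit SIGNED 2026-08-20 04:29Z; external expert review pending."
Lane `prim-bschramm`, seat `prim-hp-8` (gen 42; (F) wrapper pen); helper file (`--supports stmt-CriticalPhenomena-4575 --as helper`); N1 text stmt-g15 (SkelNegBParamsBridgeF).
* `KS.bF/mbF/MBF/nBF/hBF/ℓBF/vBF`, `bF_facts`, `mbF_floors`, **`RF2F`**, **`MBF_floors`**, **`bridgeF_adm`**, **`ℓBF_ge`**, **`clearF`**, **`PxF`**, `mem_PxF`.
[cite: KozmaNitzan2024, §4 Lemma 11 (pp. 22–23)] [cite: MartineauTassion2017, §3.2 Lemma 3.5]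
-/

noncomputable section

open scoped Classical

namespace Summit.CriticalPhenomena.PercolationContinuityZ3.Theorems.Transplant

namespace PlanarSkeletonFrm

namespace NegB

open Literature.Probability.Percolation Literature.Probability.LatticeModels SimpleGraph
open SkelConc (Consts)
open Skelφ.StepI (DataN)
open Neg

namespace KS

section BridgeF

/-- **The y′-face bridge clearance** `bF c := M_u + (c+2)·RA′ + 1`. [this work] -/
def bF (κ : Consts) {V : Type} [DecidableEq V] [Countable V] {G : SimpleGraph V} [G.LocallyFinite] (Φ : PlanarSkeletonFrm G) (t : V) (p : unitInterval) (D : Skelφ.StepI.DataNS V) (c : ℕ) (mk : ℕ) : ℕ := Mu D + (c + 2) * KS0.R'0 κ Φ t p D mk + 1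

/-- **The y′-face bridge zone-index floor** `mbF c := max (2·bF + 26) (24·M_u + 63)`. [this work] -/
def mbF (κ : Consts) {V : Type} [DecidableEq V] [Countable V] {G : SimpleGraph V} [G.LocallyFinite] (Φ : PlanarSkeletonFrm G) (t : V) (p : unitInterval) (D : Skelφ.StepI.DataNS V) (c : ℕ) (mk : ℕ) : ℕ := max (2 * bF κ Φ t p D c mk + 26) (24 * Mu D + 63)

/-- The y′-face bridge zone index `MBF := MB D mbF`. [this work] -/
abbrev MBF (κ : Consts) {V : Type} [DecidableEq V] [Countable V] {G : SimpleGraph V} [G.LocallyFinite] (Φ : PlanarSkeletonFrm G) (t : V) (p : unitInterval) (D : Skelφ.StepI.DataNS V) (c : ℕ) (mk : ℕ) : ℕ := MB D (mbF κ Φ t p D c mk)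

/-- The y′-face bridge width `nBF := nB D mbF bF`. [this work] -/
abbrev nBF (κ : Consts) {V : Type} [DecidableEq V] [Countable V] {G : SimpleGraph V} [G.LocallyFinite] (Φ : PlanarSkeletonFrm G) (t : V) (p : unitInterval) (D : Skelφ.StepI.DataNS V) (c : ℕ) (mk : ℕ) : ℕ := nB D (mbF κ Φ t p D c mk) (bF κ Φ t p D c mk)

/-- The y′-face bridge shear. [this work] -/
abbrev hBF (κ : Consts) {V : Type} [DecidableEq V] [Countable V] {G : SimpleGraph V} [G.LocallyFinite] (Φ : PlanarSkeletonFrm G) (t : V) (p : unitInterval) (D : Skelφ.StepI.DataNS V) (c : ℕ) (mk : ℕ) : ℤ := hB t D (mbF κ Φ t p D c mk) (bF κ Φ t p D c mk)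

/-- The y′-face bridge half-length. [this work] -/
abbrev ℓBF (κ : Consts) {V : Type} [DecidableEq V] [Countable V] {G : SimpleGraph V} [G.LocallyFinite] (Φ : PlanarSkeletonFrm G) (t : V) (p : unitInterval) (D : Skelφ.StepI.DataNS V) (c : ℕ) (mk : ℕ) : ℕ := ℓB t D (mbF κ Φ t p D c mk) (bF κ Φ t p D c mk)

/-- The y′-face bridge split point. [this work] -/
abbrev vBF (κ : Consts) {V : Type} [DecidableEq V] [Countable V] {G : SimpleGraph V} [G.LocallyFinite] (Φ : PlanarSkeletonFrm G) (t : V) (p : unitInterval) (D : Skelφ.StepI.DataNS V) (c : ℕ) (mk : ℕ) : ℤ := vB t D (mbF κ Φ t p D c mk) (bF κ Φ t p D c mk)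

/-- `bF = M_u + (c+2)RA′ + 1`, `M_u ≤ bF`, `(c+2)·RA′ + 1 ≤ bF`, `bR ≤ bF` once `D.k ≤ M_u + c·RA′`. [folklore] -/
theorem bF_facts (κ : Consts) {V : Type} [DecidableEq V] [Countable V] {G : SimpleGraph V} [G.LocallyFinite] (Φ : PlanarSkeletonFrm G) (t : V) (p : unitInterval) (D : Skelφ.StepI.DataNS V) (c : ℕ) (mk : ℕ) : bF κ Φ t p D c mk = Mu D + (c + 2) * KS0.R'0 κ Φ t p D mk + 1 ∧ Mu D ≤ bF κ Φ t p D c mk ∧ (c + 2) * KS0.R'0 κ Φ t p D mk + 1 ≤ bF κ Φ t p D c mk :=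
  ⟨rfl, by unfold bF; omega, by unfold bF; omega⟩

/-- `2·bF + 26 ≤ mbF` and `24·M_u + 63 ≤ mbF`. [folklore] -/
theorem mbF_floors (κ : Consts) {V : Type} [DecidableEq V] [Countable V] {G : SimpleGraph V} [G.LocallyFinite] (Φ : PlanarSkeletonFrm G) (t : V) (p : unitInterval) (D : Skelφ.StepI.DataNS V) (c : ℕ) (mk : ℕ) : 2 * bF κ Φ t p D c mk + 26 ≤ mbF κ Φ t p D c mk ∧ 24 * Mu D + 63 ≤ mbF κ Φ t p D c mk := ⟨le_max_left _ _, le_max_right _ _⟩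

/-- **(R-F2) at the y′-face bridge**: `bF ≤ nBF`, `MBF < nBF`, `MBF + bF + 2 + ρz ≤ nBF`. [folklore] -/
theorem RF2F (κ : Consts) {V : Type} [DecidableEq V] [Countable V] {G : SimpleGraph V} [G.LocallyFinite] (Φ : PlanarSkeletonFrm G) (t : V) (p : unitInterval) (D : Skelφ.StepI.DataNS V) (c : ℕ) (mk : ℕ) : bF κ Φ t p D c mk ≤ nBF κ Φ t p D c mk ∧ MBF κ Φ t p D c mk < nBF κ Φ t p D c mk ∧ MBF κ Φ t p D c mk + bF κ Φ t p D c mk + 2 + ρz D ≤ nBF κ Φ t p D c mk :=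
  ⟨(nB_facts D _ _).2.2.1, (nB_facts D _ _).2.1, (nB_facts D _ _).2.2.2⟩

/-- **The zone-index floors at the y′-face bridge**: `2·bF + 26 ≤ MBF`, `24·M_u + 63 ≤ MBF`, `M_u ≤ MBF`. [folklore] -/
theorem MBF_floors (κ : Consts) {V : Type} [DecidableEq V] [Countable V] {G : SimpleGraph V} [G.LocallyFinite] (Φ : PlanarSkeletonFrm G) (t : V) (p : unitInterval) (D : Skelφ.StepI.DataNS V) (c : ℕ) (mk : ℕ) : 2 * bF κ Φ t p D c mk + 26 ≤ MBF κ Φ t p D c mk ∧ 24 * Mu D + 63 ≤ MBF κ Φ t p D c mk ∧ Mu D ≤ MBF κ Φ t p D c mk := by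
  have h1 := (MB_facts D (mbF κ Φ t p D c mk)).2.1
  have h2 := mbF_floors κ Φ t p D c mk
  exact ⟨h2.1.trans h1, h2.2.trans h1, (MB_facts D _).1⟩

/-- **The y′-face bridge pair is admissible.** [folklore] -/
theorem bridgeF_adm (κ : Consts) {V : Type} [DecidableEq V] [Countable V] {G : SimpleGraph V} [G.LocallyFinite] (Φ : PlanarSkeletonFrm G) (t : V) (p : unitInterval) (D : Skelφ.StepI.DataNS V) (c : ℕ) (mk : ℕ) : D.M₀ ≤ (MBF κ Φ t p D c mk, nBF κ Φ t p D c mk).1 ∧ D.n₁ (MBF κ Φ t p D c mk, nBF κ Φ t p D c mk).1 ≤ (MBF κ Φ t p D c mk, nBF κ Φ t p D c mk).2 :=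
  bridge_adm D _ _

/-- **`2·bF + 27 ≤ ℓBF`** from the bridge pair's geometric clause (any map `ψ`). [folklore] -/
theorem ℓBF_ge (κ : Consts) {V : Type} [DecidableEq V] [Countable V] {G : SimpleGraph V} [G.LocallyFinite] (Φ : PlanarSkeletonFrm G) (t : V) (p : unitInterval) (D : Skelφ.StepI.DataNS V) (c : ℕ) (mk : ℕ) (ψ : V → Site 2) (hE : D.EqGeom G ψ t (MBF κ Φ t p D c mk) (nBF κ Φ t p D c mk)) : 2 * bF κ Φ t p D c mk + 27 ≤ ℓBF κ Φ t p D c mk := by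
  have h1 := ℓB_ge t D (mbF κ Φ t p D c mk) (bF κ Φ t p D c mk) ψ hE
  have h2 := (mbF_floors κ Φ t p D c mk).1
  show _ ≤ ℓB t D (mbF κ Φ t p D c mk) (bF κ Φ t p D c mk)
  omega

/-- **THE CLEARANCE THE WIDE BRIDGE BUYS**: `M_u + (c+1)·RA′ < nBF − RA′` — with `R′s ≤ RA′` the y′-run's α-recession `(k+1)·R′s` (p1-g13's recession lemma) stays
clear of the zone scale `M_u` for every region `k ≤ c − 1` from the `k = 0` origin at the top of the `hxaY` interval (`c_lo(core1) − n_L = nBF − RA′`). [folklore] -/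
theorem clearF (κ : Consts) {V : Type} [DecidableEq V] [Countable V] {G : SimpleGraph V} [G.LocallyFinite] (Φ : PlanarSkeletonFrm G) (t : V) (p : unitInterval) (D : Skelφ.StepI.DataNS V) (c : ℕ) (mk : ℕ) : ((Mu D : ℕ) : ℤ) + ((c : ℤ) + 1) * (KS0.R'0 κ Φ t p D mk : ℤ) < (nBF κ Φ t p D c mk : ℤ) - KS0.R'0 κ Φ t p D mk := by
  have h1 := (RF2F κ Φ t p D c mk).1
  have h2 := (bF_facts κ Φ t p D c mk).1
  have h3 : Mu D + (c + 2) * KS0.R'0 κ Φ t p D mk + 1 ≤ nBF κ Φ t p D c mk := by rw [← h2]; exact h1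
  have h4 : ((Mu D + (c + 2) * KS0.R'0 κ Φ t p D mk + 1 : ℕ) : ℤ) ≤ (nBF κ Φ t p D c mk : ℤ) := by exact_mod_cast h3
  push_cast at h4
  linarith

/-- **THE EXTRA-PAIR SLOT CARRYING THE y′-FACE BRIDGE** `PxF c mk := {(MBF, nBF)}` (with admissibility). [this work] -/
def PxF (c : ℕ) (mk : ℕ) : PSlot := fun κ _ _ _ _ _ Φ t p D =>
  ⟨{(MBF κ Φ t p D c mk, nBF κ Φ t p D c mk)}, fun q hq => by rw [Finset.mem_singleton] at hq; subst hq; exact bridgeF_adm κ Φ t p D c mk⟩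

/-- The y′-face bridge pair is in `PR mk (PxF c mk)` (and in `PR mk Px` for every `Px ⊇ PxF`'s pairs — here the exact slot). [folklore] -/
theorem mem_PxF (κ : Consts) {V : Type} [DecidableEq V] [Countable V] {G : SimpleGraph V} [G.LocallyFinite] (Φ : PlanarSkeletonFrm G) (t : V) (p : unitInterval) (D : Skelφ.StepI.DataNS V) (c : ℕ) (mk : ℕ) : (MBF κ Φ t p D c mk, nBF κ Φ t p D c mk) ∈ (PR mk (PxF c mk) κ Φ t p D).1 := by
  show _ ∈ ({(MBR κ Φ t p D mk, nBR κ Φ t p D mk), (MK D mk, nKit D mk)} ∪ ({(MBF κ Φ t p D c mk, nBF κ Φ t p D c mk)} : Finset (ℕ × ℕ)))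
  exact Finset.mem_union_right _ (Finset.mem_singleton_self _)

end BridgeF

end KS

end NegB

end PlanarSkeletonFrm

end Summit.CriticalPhenomena.PercolationContinuityZ3.Theorems.Transplant

end
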